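import Summits.BirchSwinnertonDyer.BirchSwinnertonDyer.Theorems.SmallImageMuTransferAnalyticMuZeroX9TeichSpanDefs
import HarnessLib

/-!
# LEVEL DESCENT (cofinality) for CONJ B⁰ = `TeichSpanGen` — seat `bsd-idea-13` g11 (lens = strengthen, STUB level)

Crux `KobayashiMainConjectureSmallImage` (item stmt-BirchSwinnertonDyer-19002, route `SignedLowerHalves`, rank 4),
line of record `Lines/birth_acns.lean` v10 (LEAD `bsd-line-slh-p3`).  Its `p ≥ 5` one-sign `μ`-rider
`stub_muOneSign_ns_ge5` is, since 2026-08-28T15:29Z, a kernel consequence of the cell conjecture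
`TeichSpanGenAll` (tree `Theorems/SignedLowerHalvesKobayashiMainConjectureSmallImageTeichOrbitMu.lean`,
`muOneSign_ns_ge5_of_teichSpanGenAll`; vocabulary `Theorems/SmallImageMuTransferAnalyticMuZeroX9TeichSpanDefs.lean`,
cell `bsd-f3-mu`, LINE C `teichSpan-x9` on item 19630, registered stub `stub_teichSpanGenAll`).

WHAT THIS FILE PROVES (sorry-free; group theory of `Γ₀(N)` only; nothing about any curve or form):
* `teichSpanGen_of_dvd` — **level descent**: for `N ∣ N'` and `p ∤ N'`, `TeichSpanGen N' p → TeichSpanGen N p`.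
  Proof: a good `γ ∈ Γ₀(N)` (`|d| = pᵐ`) factors as `γ = γ'·L` with `γ' ∈ Γ₀(N')` having the SAME second column
  (Bezout on `gcd(d, b·N') = 1`, which is where `p ∤ N'` enters) and `L ∈ Γ₀(N)` unipotent of trace `2` (a generator);
  Teichmüller packets / finite-order / trace-`±2` / `p`-th powers / commutators of `Γ₀(N')` push forward to those of
  `Γ₀(N)` along `Γ₀(N') ≤ Γ₀(N)`; and `x y x^ι y^ι = (x x^ι)·⁅(x^ι)⁻¹, y⁆·y·y^ι`.
* `teichSpanGenAll_iff_forall_mul` — **cofinality**: for ANY auxiliary modulus `M p` prime to `p`,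
  `TeichSpanGenAll ↔ (B⁰ on the levels divisible by M p)`; instances `teichSpanGenAll_iff_forall_dvd_four`,
  `…_dvd_thirtySix`, `…_auxPrime_dvd` (an auxiliary prime `q p ≠ p` in the level).
* §4 (v2): at `4 ∣ N` the group `Γ₀(N)` has NO ELLIPTIC ELEMENTS — `eq_one_or_eq_negOne_of_isOfFinOrder_of_four_dvd`
  (finite order ⇒ `±1`; integer Chebyshev recursion `sl2z_exists_pow_succ_eq` + `a(t−a) ≡ 1 (mod 4)` insoluble for
  `t ∈ {0,±1}`, `decide`), hence `teichSpanGenerators_eq_of_four_dvd`: on the cofinal family `4 ∣ N` the generator set is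
  just «packets ∪ trace ±2 ∪ p-th powers» (`Γ₀(N)/±1` free).
USE: any attack on `stub_teichSpanGenAll` (Vaserstein / `SL₂(ℤ[1/p])` language, MEMO-an §14.11) may assume `4 ∣ N`
(torsion-free `Γ₀(N)/±1`, no elliptic generators) and/or an auxiliary prime `q ≠ p` in the level; a disproof of B⁰ at
one level `N₀` refutes it at every multiple `N₀ ∣ N'`, `p ∤ N'` (extend the census at SMALL levels first).
Homological reading: `π_* : H₁(X₀(N');𝔽_p) → H₁(X₀(N);𝔽_p)` maps packets onto packets and `(1+ι)V(N',p)` onto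
`(1+ι)V(N,p)`, so B⁰ is monotone under level lowering.

HONEST FRAMING: `TeichSpanGenAll` / B⁰ stays OPEN (census 61/61, cell `bsd-f3-mu`); this file neither proves nor
weakens it, it proves an implication between its instances.  Not registered as a line (W-79); not a route (W-71).
beyond-print theorem: no (elementary).  BSD is not proved by any of this; crux 19002 stays OPEN.
References: [Manin1972] Prop. 1.4 (the dictionary `γ ↦ {0 → γ·0}`); [Sun2007] §4 (good elements); [DiamondShurman2005]
Prop. 2.3.3, §3.7–3.8 (elliptic points of `Γ₀(N)`); [Freitag1990] Ch. I Remark 1.5 (Chebyshev recursion); MEMO-an §14.11.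
-/

set_option linter.dupNamespace false
set_option autoImplicit false

noncomputable section

open scoped Classical MatrixGroups commutatorElement
open CongruenceSubgroup
open Literature.NumberTheory.EllipticCurves.Rank1Residual
open Summit.BirchSwinnertonDyer.BirchSwinnertonDyer.Cruxes.AnalyticMuZeroX9.TeichSpan

namespace Summit.BirchSwinnertonDyer.BirchSwinnertonDyer.Cruxes.KobayashiMainConjectureSmallImage.TeichSpanLevelDescent

variable {N N' : ℕ}

/-! ### §1 The inclusion `Γ₀(N') ≤ Γ₀(N)` for `N ∣ N'` and what it preserves -/

/-- `N ∣ N' → Γ₀(N') ≤ Γ₀(N)`. [folklore] -/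
theorem gamma0_le_of_dvd (h : N ∣ N') : Gamma0 N' ≤ Gamma0 N := by
  intro γ hγ
  rw [Gamma0_mem] at hγ ⊢
  rw [ZMod.intCast_zmod_eq_zero_iff_dvd] at hγ ⊢
  exact (Int.natCast_dvd_natCast.mpr h).trans hγ

/-- The inclusion homomorphism `Γ₀(N') →* Γ₀(N)` for `N ∣ N'`. [folklore] -/
def incl (h : N ∣ N') : Gamma0 N' →* Gamma0 N := Subgroup.inclusion (gamma0_le_of_dvd h)

@[simp] theorem coe_incl (h : N ∣ N') (γ : Gamma0 N') :
    ((incl h γ : Gamma0 N) : SL(2, ℤ)) = (γ : SL(2, ℤ)) := rfl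

@[simp] theorem dEntry_incl (h : N ∣ N') (γ : Gamma0 N') : dEntry (incl h γ) = dEntry γ := rfl

@[simp] theorem bEntry_incl (h : N ∣ N') (γ : Gamma0 N') : bEntry (incl h γ) = bEntry γ := rfl

@[simp] theorem trEntry_incl (h : N ∣ N') (γ : Gamma0 N') : trEntry (incl h γ) = trEntry γ := rfl

theorem incl_iotaGamma0 (h : N ∣ N') (γ : Gamma0 N') : incl h (iotaGamma0 γ) = iotaGamma0 (incl h γ) :=
  Subtype.ext rfl

theorem isGoodAt_incl (h : N ∣ N') {p : ℕ} {γ : Gamma0 N'} (hγ : IsGoodAt p γ) : IsGoodAt p (incl h γ) := hγ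

/-- `ι` is multiplicative on `SL₂(ℤ)` (it is conjugation by `diag(-1,1)`). [cite: Manin1972, Prop. 1.4] -/
theorem iotaSL_mul (x y : SL(2, ℤ)) : iotaSL (x * y) = iotaSL x * iotaSL y := by
  ext i j
  fin_cases i <;> fin_cases j <;>
    simp [iotaSL, Matrix.mul_apply, Fin.sum_univ_two] <;> ring

/-- `ι` is multiplicative on `Γ₀(N)`. [cite: Manin1972, Prop. 1.4] -/
theorem iotaGamma0_mul (x y : Gamma0 N) : iotaGamma0 (x * y) = iotaGamma0 x * iotaGamma0 y :=
  Subtype.ext <| by simp only [coe_iotaGamma0, Subgroup.coe_mul, iotaSL_mul]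

/-- Teichmüller packets of `Γ₀(N')` are Teichmüller packets of `Γ₀(N)`. [cite: Manin1972, Prop. 1.4] -/
theorem isTeichPacket_map_incl (h : N ∣ N') {p n : ℕ} {l : List (Gamma0 N')} (hl : IsTeichPacket N' p n l) :
    IsTeichPacket N p n (l.map (incl h)) := by
  obtain ⟨hlen, hd, hnodup, c, hc⟩ := hl
  refine ⟨by simpa using hlen, ?_, ?_, c, ?_⟩
  · intro g hg
    obtain ⟨g', hg', rfl⟩ := List.mem_map.mp hg
    exact hd g' hg'
  · rw [List.map_map]
    exact hnodup
  · intro g hg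
    obtain ⟨g', hg', rfl⟩ := List.mem_map.mp hg
    exact hc g' hg'

/-- The generators of `Γ₀(N')` push forward to generators of `Γ₀(N)`. [cite: Manin1972, Prop. 1.4] -/
theorem incl_mem_teichSpanGenerators (h : N ∣ N') {p : ℕ} {γ : Gamma0 N'}
    (hγ : γ ∈ teichSpanGenerators N' p) : incl h γ ∈ teichSpanGenerators N p := by
  simp only [teichSpanGenerators, teichPacketProducts, Set.mem_union, Set.mem_setOf_eq] at hγ
  rcases hγ with ((⟨n, l, hn, hl, rfl⟩ | hfin | htr) | ⟨h', rfl⟩)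
  · rw [map_list_prod]
    exact prod_mem_teichSpanGenerators hn (isTeichPacket_map_incl h hl)
  · exact mem_teichSpanGenerators_of_isOfFinOrder ((incl h).isOfFinOrder hfin)
  · exact mem_teichSpanGenerators_of_trEntry htr
  · rw [map_pow]
    exact pow_mem_teichSpanGenerators _

/-- `⟨generators⟩·[Γ₀(N'),Γ₀(N')]` pushes forward into `⟨generators⟩·[Γ₀(N),Γ₀(N)]`. [cite: Manin1972, Prop. 1.4] -/
theorem map_closure_sup_commutator_le (h : N ∣ N') (p : ℕ) :
    (Subgroup.closure (teichSpanGenerators N' p) ⊔ commutator (Gamma0 N')).map (incl h) ≤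
      Subgroup.closure (teichSpanGenerators N p) ⊔ commutator (Gamma0 N) := by
  rw [Subgroup.map_sup]
  apply sup_le_sup
  · rw [MonoidHom.map_closure]
    apply Subgroup.closure_mono
    rintro _ ⟨γ, hγ, rfl⟩
    exact incl_mem_teichSpanGenerators h hγ
  · rw [commutator_def, commutator_def, Subgroup.map_commutator]
    exact Subgroup.commutator_mono le_top le_top

/-! ### §2 Same-second-column factorisation `γ = γ'·L` (`γ' ∈ Γ₀(N')`, `L` unipotent) -/

/-- For `N ∣ N'`, `p ∤ N'` and a good `γ = (a b; c d) ∈ Γ₀(N)` (`|d| = pᵐ`): there is `γ' ∈ Γ₀(N')` with the same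
second column `(b, d)` (so `γ'` is good) and a trace-`2` element `L = (1 0; t 1) ∈ Γ₀(N)` with `γ = γ'·L`.
(Bezout on `gcd(d, b·N') = 1`.) [cite: Sun2007, §4] -/
theorem exists_eq_incl_mul_of_isGoodAt (h : N ∣ N') {p : ℕ} (hp : p.Prime) (hpN' : ¬ p ∣ N')
    {γ : Gamma0 N} (hγ : IsGoodAt p γ) :
    ∃ (γ' : Gamma0 N') (L : Gamma0 N), IsGoodAt p γ' ∧ trEntry L = 2 ∧ γ = incl h γ' * L := by
  obtain ⟨m, hm⟩ := hγ
  -- names for the entries of γ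
  set g : Matrix (Fin 2) (Fin 2) ℤ := ((γ : SL(2, ℤ)) : Matrix (Fin 2) (Fin 2) ℤ) with hg_def
  have hdet : g 0 0 * g 1 1 - g 0 1 * g 1 0 = 1 := by
    have := (γ : SL(2, ℤ)).det_coe
    rw [Matrix.det_fin_two] at this
    exact this
  have hγ10 : (N : ℤ) ∣ g 1 0 := (ZMod.intCast_zmod_eq_zero_iff_dvd _ _).mp (Gamma0_mem.mp γ.2)
  have hNN' : (N : ℤ) ∣ (N' : ℤ) := Int.natCast_dvd_natCast.mpr h
  -- gcd(d, b N') = 1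
  have hdb : IsCoprime (g 1 1) (g 0 1) := ⟨g 0 0, -g 1 0, by linear_combination hdet⟩
  have hdN' : IsCoprime (g 1 1) (N' : ℤ) := by
    rw [Int.isCoprime_iff_gcd_eq_one]
    show Nat.gcd (g 1 1).natAbs (N' : ℤ).natAbs = 1
    have hm' : (g 1 1).natAbs = p ^ m := hm
    rw [hm', Int.natAbs_natCast]
    exact Nat.Coprime.pow_left m ((Nat.Prime.coprime_iff_not_dvd hp).mpr hpN')
  obtain ⟨x, y, hxy⟩ := hdb.mul_right hdN'
  -- γ' := (x b; -y N' d) ∈ Γ₀(N')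
  let γ'SL : SL(2, ℤ) := ⟨!![x, g 0 1; -(y * N'), g 1 1], by
    rw [Matrix.det_fin_two_of]; linear_combination hxy⟩
  have hγ'mem : γ'SL ∈ Gamma0 N' := by
    rw [Gamma0_mem]
    show (((-(y * (N' : ℤ)) : ℤ) : ZMod N') = 0)
    rw [ZMod.intCast_zmod_eq_zero_iff_dvd]
    exact (dvd_mul_left (N' : ℤ) y).neg_right
  -- L := (1 0; t 1) ∈ Γ₀(N), t = y N' a + x c
  let t : ℤ := y * N' * g 0 0 + x * g 1 0
  have ht : (N : ℤ) ∣ t :=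
    dvd_add (dvd_mul_of_dvd_left (dvd_mul_of_dvd_right hNN' y) _) (dvd_mul_of_dvd_right hγ10 x)
  let LSL : SL(2, ℤ) := ⟨!![1, 0; t, 1], by rw [Matrix.det_fin_two_of]; ring⟩
  have hLmem : LSL ∈ Gamma0 N := by
    rw [Gamma0_mem]
    show ((t : ℤ) : ZMod N) = 0
    rw [ZMod.intCast_zmod_eq_zero_iff_dvd]
    exact ht
  refine ⟨⟨γ'SL, hγ'mem⟩, ⟨LSL, hLmem⟩, ⟨m, hm⟩, ?_, ?_⟩
  · show (1 : ℤ) + 1 = 2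
    norm_num
  · -- the matrix identity γ = γ'·L, from `hdet` and `hxy`
    apply Subtype.ext
    rw [Subgroup.coe_mul, coe_incl]
    ext i j
    rw [Matrix.SpecialLinearGroup.coe_mul]
    fin_cases i <;> fin_cases j
    · show g 0 0 = (!![x, g 0 1; -(y * N'), g 1 1] * !![1, 0; t, 1]) 0 0
      simp [Matrix.mul_apply, Fin.sum_univ_two, t]
      linear_combination (-(g 0 0)) * hxy + x * hdet
    · show g 0 1 = (!![x, g 0 1; -(y * N'), g 1 1] * !![1, 0; t, 1]) 0 1
      simp [Matrix.mul_apply, Fin.sum_univ_two]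
    · show g 1 0 = (!![x, g 0 1; -(y * N'), g 1 1] * !![1, 0; t, 1]) 1 0
      simp [Matrix.mul_apply, Fin.sum_univ_two, t]
      linear_combination (-(g 1 0)) * hxy + (-(y * N')) * hdet
    · show g 1 1 = (!![x, g 0 1; -(y * N'), g 1 1] * !![1, 0; t, 1]) 1 1
      simp [Matrix.mul_apply, Fin.sum_univ_two]

/-! ### §3 Level descent and cofinality -/

/-- **LEVEL DESCENT for B⁰.** For `N ∣ N'` and `p ∤ N'`: `TeichSpanGen N' p → TeichSpanGen N p`.
[cite: Manin1972, Prop. 1.4] [cite: Sun2007, §4] -/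
theorem teichSpanGen_of_dvd (h : N ∣ N') {p : ℕ} (hp : p.Prime) (hpN' : ¬ p ∣ N')
    (hB : TeichSpanGen N' p) : TeichSpanGen N p := by
  intro γ hγ
  obtain ⟨γ', L, hγ', hL, rfl⟩ := exists_eq_incl_mul_of_isGoodAt h hp hpN' hγ
  set S := Subgroup.closure (teichSpanGenerators N p) ⊔ commutator (Gamma0 N) with hS_def
  have hx : incl h γ' * iotaGamma0 (incl h γ') ∈ S := by
    have h1 := hB γ' hγ'
    have h2 : incl h (γ' * iotaGamma0 γ') ∈ S :=
      map_closure_sup_commutator_le h p (Subgroup.mem_map_of_mem (incl h) h1)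
    rwa [map_mul, incl_iotaGamma0] at h2
  have hy : L ∈ S :=
    Subgroup.mem_sup_left (Subgroup.subset_closure (mem_teichSpanGenerators_of_trEntry (Or.inl hL)))
  have hy' : iotaGamma0 L ∈ S :=
    Subgroup.mem_sup_left (Subgroup.subset_closure
      (mem_teichSpanGenerators_of_trEntry (Or.inl (by rw [trEntry_iotaGamma0]; exact hL))))
  have hc : ⁅(iotaGamma0 (incl h γ'))⁻¹, L⁆ ∈ S :=
    Subgroup.mem_sup_right (Subgroup.commutator_mem_commutator (Subgroup.mem_top _) (Subgroup.mem_top _))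
  rw [iotaGamma0_mul]
  have key : incl h γ' * L * (iotaGamma0 (incl h γ') * iotaGamma0 L)
      = (incl h γ' * iotaGamma0 (incl h γ')) * ⁅(iotaGamma0 (incl h γ'))⁻¹, L⁆ * L * iotaGamma0 L := by
    simp only [commutatorElement_def]; group
  rw [key]
  exact Subgroup.mul_mem _ (Subgroup.mul_mem _ (Subgroup.mul_mem _ hx hc) hy) hy'

/-- **COFINALITY.** For any auxiliary modulus `M p` prime to `p` (`p ≥ 5`): B⁰ at all levels prime to `p` is
equivalent to B⁰ at the levels prime to `p` that are divisible by `M p`. [cite: Manin1972, Prop. 1.4] -/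
theorem teichSpanGenAll_iff_forall_mul (M : ℕ → ℕ) (hM : ∀ p : ℕ, p.Prime → 5 ≤ p → ¬ p ∣ M p) :
    TeichSpanGenAll ↔
      ∀ (N p : ℕ), p.Prime → 5 ≤ p → ¬ p ∣ N → M p ∣ N → TeichSpanGen N p := by
  constructor
  · intro hB N p hp h5 hpN _
    exact hB N p hp h5 hpN
  · intro hB N p hp h5 hpN
    have hpMN : ¬ p ∣ M p * N := by
      intro hdvd
      rcases (Nat.Prime.dvd_mul hp).mp hdvd with h1 | h2
      · exact hM p hp h5 h1
      · exact hpN h2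
    exact teichSpanGen_of_dvd (Dvd.intro_left _ rfl) hp hpMN (hB (M p * N) p hp h5 hpMN (Dvd.intro _ rfl))

/-- **COFINALITY at `36 ∣ N`** (no elliptic elements in `Γ₀(N)`: `a² ≡ -1 (mod 4)` and `a² - a + 1 ≡ 0 (mod 9)` are
insoluble, so the finite-order generators are `±1` and `Γ₀(N)/±1` is free):
`TeichSpanGenAll ↔ ∀ N p, p prime, 5 ≤ p, p ∤ N, 36 ∣ N → TeichSpanGen N p`. [cite: Manin1972, Prop. 1.4] -/
theorem teichSpanGenAll_iff_forall_dvd_thirtySix :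
    TeichSpanGenAll ↔
      ∀ (N p : ℕ), p.Prime → 5 ≤ p → ¬ p ∣ N → 36 ∣ N → TeichSpanGen N p := by
  refine teichSpanGenAll_iff_forall_mul (fun _ => 36) ?_
  intro p hp h5 hd
  have h36 : p ∣ 36 := hd
  have hle : p ≤ 36 := Nat.le_of_dvd (by norm_num) h36
  interval_cases p <;> first | (norm_num at h36; done) | norm_num at hp

/-- **COFINALITY with an auxiliary prime in the level**: for any choice of primes `q p ≠ p`,
`TeichSpanGenAll ↔ ∀ N p, p prime, 5 ≤ p, p ∤ N, q p ∣ N → TeichSpanGen N p`. [cite: Manin1972, Prop. 1.4] -/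
theorem teichSpanGenAll_iff_forall_auxPrime_dvd (q : ℕ → ℕ) (hq : ∀ p, (q p).Prime) (hqp : ∀ p, q p ≠ p) :
    TeichSpanGenAll ↔
      ∀ (N p : ℕ), p.Prime → 5 ≤ p → ¬ p ∣ N → q p ∣ N → TeichSpanGen N p := by
  refine teichSpanGenAll_iff_forall_mul q ?_
  intro p hp _ hd
  exact hqp p ((Nat.prime_dvd_prime_iff_eq hp (hq p)).mp hd).symm


/-! ### §4 At `4 ∣ N` there are no elliptic generators (so the cofinal family `4 ∣ N` has torsion-free `Γ₀(N)/±1`) -/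

/-- Chebyshev recursion in `SL₂(ℤ)`: if `|tr g| ≥ 2` then `g^(n+1) = u·g + w·1` (entrywise) with `|w| < |u|`.
[cite: Freitag1990, Ch. I §1 Remark 1.5] -/
theorem sl2z_exists_pow_succ_eq (g : SL(2, ℤ))
    (ht : 2 ≤ |(g : Matrix (Fin 2) (Fin 2) ℤ) 0 0 + (g : Matrix (Fin 2) (Fin 2) ℤ) 1 1|) (n : ℕ) :
    ∃ u w : ℤ,
      (((g ^ (n + 1) : SL(2, ℤ)) : Matrix (Fin 2) (Fin 2) ℤ) 0 0 = u * (g : Matrix (Fin 2) (Fin 2) ℤ) 0 0 + w ∧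
       ((g ^ (n + 1) : SL(2, ℤ)) : Matrix (Fin 2) (Fin 2) ℤ) 0 1 = u * (g : Matrix (Fin 2) (Fin 2) ℤ) 0 1 ∧
       ((g ^ (n + 1) : SL(2, ℤ)) : Matrix (Fin 2) (Fin 2) ℤ) 1 0 = u * (g : Matrix (Fin 2) (Fin 2) ℤ) 1 0 ∧
       ((g ^ (n + 1) : SL(2, ℤ)) : Matrix (Fin 2) (Fin 2) ℤ) 1 1 = u * (g : Matrix (Fin 2) (Fin 2) ℤ) 1 1 + w) ∧
      |w| < |u| := by
  set M : Matrix (Fin 2) (Fin 2) ℤ := (g : Matrix (Fin 2) (Fin 2) ℤ) with hM_def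
  have hdet : M 0 0 * M 1 1 - M 0 1 * M 1 0 = 1 := by
    have := g.det_coe
    rw [Matrix.det_fin_two] at this
    exact this
  induction n with
  | zero => exact ⟨1, 0, by simp [hM_def], by simp⟩
  | succ n ih =>
    obtain ⟨u, w, ⟨h00, h01, h10, h11⟩, hlt⟩ := ih
    refine ⟨u * (M 0 0 + M 1 1) + w, -u, ?_, ?_⟩
    · have hP : ((g ^ (n + 1 + 1) : SL(2, ℤ)) : Matrix (Fin 2) (Fin 2) ℤ)
          = ((g ^ (n + 1) : SL(2, ℤ)) : Matrix (Fin 2) (Fin 2) ℤ) * M := by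
        rw [pow_succ, Matrix.SpecialLinearGroup.coe_mul]
      refine ⟨?_, ?_, ?_, ?_⟩
      · rw [hP, Matrix.mul_apply, Fin.sum_univ_two, h00, h01]
        linear_combination (-u) * hdet
      · rw [hP, Matrix.mul_apply, Fin.sum_univ_two, h00, h01]
        ring
      · rw [hP, Matrix.mul_apply, Fin.sum_univ_two, h10, h11]
        ring
      · rw [hP, Matrix.mul_apply, Fin.sum_univ_two, h10, h11]
        linear_combination (-u) * hdet
    · rw [abs_neg]
      have h2 : 2 * |u| ≤ |u * (M 0 0 + M 1 1)| := by
        rw [abs_mul]; nlinarith [abs_nonneg u, ht]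
      have h3 : |u * (M 0 0 + M 1 1)| ≤ |u * (M 0 0 + M 1 1) + w| + |w| := by
        have := abs_sub (u * (M 0 0 + M 1 1) + w) w
        simpa using this
      linarith

/-- In `SL₂(ℤ)` an element of finite order with `|tr| ≥ 2` is `±1` (the Chebyshev coefficients force it to be scalar).
[cite: Freitag1990, Ch. I §1 Remark 1.5] [cite: DiamondShurman2005, Prop. 2.3.3] -/
theorem sl2z_eq_one_or_neg_one_of_isOfFinOrder (g : SL(2, ℤ)) (hfin : IsOfFinOrder g)
    (ht : 2 ≤ |(g : Matrix (Fin 2) (Fin 2) ℤ) 0 0 + (g : Matrix (Fin 2) (Fin 2) ℤ) 1 1|) :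
    g = 1 ∨ g = -1 := by
  obtain ⟨k, hk, hgk⟩ := isOfFinOrder_iff_pow_eq_one.mp hfin
  obtain ⟨n, rfl⟩ : ∃ n, k = n + 1 := Nat.exists_eq_succ_of_ne_zero hk.ne'
  obtain ⟨u, w, ⟨e00, e01, e10, e11⟩, hlt⟩ := sl2z_exists_pow_succ_eq g ht n
  rw [hgk] at e00 e01 e10 e11
  simp only [Matrix.SpecialLinearGroup.coe_one, Matrix.one_apply_eq, Matrix.one_apply_ne (by decide : (0 : Fin 2) ≠ 1),
    Matrix.one_apply_ne (by decide : (1 : Fin 2) ≠ 0)] at e00 e01 e10 e11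
  set M : Matrix (Fin 2) (Fin 2) ℤ := (g : Matrix (Fin 2) (Fin 2) ℤ) with hM_def
  have hu : u ≠ 0 := by
    rintro rfl
    have := abs_nonneg w
    simp at hlt
    linarith
  have hdet : M 0 0 * M 1 1 - M 0 1 * M 1 0 = 1 := by
    have := g.det_coe
    rw [Matrix.det_fin_two] at this
    exact this
  have h01 : M 0 1 = 0 := by
    rcases mul_eq_zero.mp e01.symm with h | h
    · exact absurd h hu
    · exact h
  have h10 : M 1 0 = 0 := by
    rcases mul_eq_zero.mp e10.symm with h | h
    · exact absurd h hu
    · exact h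
  have hdiag : M 0 0 = M 1 1 := mul_left_cancel₀ hu (by linarith)
  have hsq : M 0 0 * M 0 0 = 1 := by
    rw [h01, h10, ← hdiag] at hdet
    linarith
  rcases mul_self_eq_one_iff.mp hsq with h | h
  · left
    ext i j
    fin_cases i <;> fin_cases j <;> simp [← hM_def, h01, h10, h, ← hdiag]
  · right
    ext i j
    fin_cases i <;> fin_cases j <;> simp [← hM_def, h01, h10, h, ← hdiag]

/-- **No elliptic elements at `4 ∣ N`**: a finite-order element of `Γ₀(N)`, `4 ∣ N`, is `±1` (its trace `t = a + d`
would satisfy `a(t − a) ≡ 1 (mod 4)` with `t ∈ {0, ±1}`, insoluble).  [cite: DiamondShurman2005, §3.7–3.8 (ε₂ = ε₃ = 0 iff …)] -/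
theorem eq_one_or_eq_negOne_of_isOfFinOrder_of_four_dvd (h4 : 4 ∣ N) {γ : Gamma0 N} (hfin : IsOfFinOrder γ) :
    γ = 1 ∨ γ = negOneGamma0 N := by
  have hfin' : IsOfFinOrder (γ : SL(2, ℤ)) := (Gamma0 N).subtype.isOfFinOrder hfin
  set M : Matrix (Fin 2) (Fin 2) ℤ := ((γ : SL(2, ℤ)) : Matrix (Fin 2) (Fin 2) ℤ) with hM_def
  have hdet : M 0 0 * M 1 1 - M 0 1 * M 1 0 = 1 := by
    have := (γ : SL(2, ℤ)).det_coe
    rw [Matrix.det_fin_two] at this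
    exact this
  have hc : (4 : ℤ) ∣ M 1 0 :=
    (Int.natCast_dvd_natCast.mpr h4).trans ((ZMod.intCast_zmod_eq_zero_iff_dvd _ _).mp (Gamma0_mem.mp γ.2))
  have ht : 2 ≤ |M 0 0 + M 1 1| := by
    by_contra hlt
    rw [not_le] at hlt
    have key : ∀ a d : ZMod 4, a * d = 1 → ¬ (a + d = 0 ∨ a + d = 1 ∨ a + d = -1) := by decide
    have hc0 : ((M 1 0 : ℤ) : ZMod 4) = 0 := (ZMod.intCast_zmod_eq_zero_iff_dvd _ _).mpr hc
    have h1 : ((M 0 0 : ℤ) : ZMod 4) * ((M 1 1 : ℤ) : ZMod 4) = 1 := by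
      have := congrArg (Int.cast : ℤ → ZMod 4) hdet
      push_cast at this
      rw [hc0, mul_zero, sub_zero] at this
      exact this
    have htr : M 0 0 + M 1 1 = 0 ∨ M 0 0 + M 1 1 = 1 ∨ M 0 0 + M 1 1 = -1 := by
      have := abs_lt.mp hlt
      omega
    have h2 : ((M 0 0 : ℤ) : ZMod 4) + ((M 1 1 : ℤ) : ZMod 4) = 0 ∨
        ((M 0 0 : ℤ) : ZMod 4) + ((M 1 1 : ℤ) : ZMod 4) = 1 ∨
        ((M 0 0 : ℤ) : ZMod 4) + ((M 1 1 : ℤ) : ZMod 4) = -1 := by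
      rcases htr with h | h | h
      · left; exact_mod_cast congrArg (Int.cast : ℤ → ZMod 4) h
      · right; left; exact_mod_cast congrArg (Int.cast : ℤ → ZMod 4) h
      · right; right; exact_mod_cast congrArg (Int.cast : ℤ → ZMod 4) h
    exact key _ _ h1 h2
  rcases sl2z_eq_one_or_neg_one_of_isOfFinOrder _ hfin' ht with h | h
  · left
    exact Subtype.ext h
  · right
    exact Subtype.ext h

/-- At `4 ∣ N` a finite-order element of `Γ₀(N)` has trace `±2` — so the «finite order» clause of `teichSpanGenerators`
is redundant there. [cite: DiamondShurman2005, §3.7–3.8] -/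
theorem trEntry_of_isOfFinOrder_of_four_dvd (h4 : 4 ∣ N) {γ : Gamma0 N} (hfin : IsOfFinOrder γ) :
    trEntry γ = 2 ∨ trEntry γ = -2 := by
  rcases eq_one_or_eq_negOne_of_isOfFinOrder_of_four_dvd h4 hfin with rfl | rfl
  · left
    show ((1 : SL(2, ℤ)) : Matrix (Fin 2) (Fin 2) ℤ) 0 0 + ((1 : SL(2, ℤ)) : Matrix (Fin 2) (Fin 2) ℤ) 1 1 = 2
    simp
  · right
    exact trEntry_negOneGamma0 N

/-- **The generator set at `4 ∣ N`**: packets, trace-`±2` elements and `p`-th powers only (no elliptic generators).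
[cite: Manin1972, Prop. 1.4] [cite: DiamondShurman2005, §3.7–3.8] -/
theorem teichSpanGenerators_eq_of_four_dvd (h4 : 4 ∣ N) (p : ℕ) :
    teichSpanGenerators N p =
      teichPacketProducts N p ∪ {γ | trEntry γ = 2 ∨ trEntry γ = -2} ∪ {γ | ∃ h : Gamma0 N, γ = h ^ p} := by
  ext γ
  simp only [teichSpanGenerators, Set.mem_union, Set.mem_setOf_eq]
  constructor
  · rintro ((hP | hfin | htr) | hpow)
    · exact Or.inl (Or.inl hP)
    · exact Or.inl (Or.inr (trEntry_of_isOfFinOrder_of_four_dvd h4 hfin))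
    · exact Or.inl (Or.inr htr)
    · exact Or.inr hpow
  · rintro ((hP | htr) | hpow)
    · exact Or.inl (Or.inl hP)
    · exact Or.inl (Or.inr (Or.inr htr))
    · exact Or.inr hpow

/-- **COFINALITY at `4 ∣ N`** (torsion-free `Γ₀(N)/±1`, generator set of `teichSpanGenerators_eq_of_four_dvd`):
`TeichSpanGenAll ↔ ∀ N p, p prime, 5 ≤ p, p ∤ N, 4 ∣ N → TeichSpanGen N p`. [cite: Manin1972, Prop. 1.4] -/
theorem teichSpanGenAll_iff_forall_dvd_four :
    TeichSpanGenAll ↔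
      ∀ (N p : ℕ), p.Prime → 5 ≤ p → ¬ p ∣ N → 4 ∣ N → TeichSpanGen N p := by
  refine teichSpanGenAll_iff_forall_mul (fun _ => 4) ?_
  intro p _ h5 hd
  have := Nat.le_of_dvd (by norm_num) hd
  omega

end Summit.BirchSwinnertonDyer.BirchSwinnertonDyer.Cruxes.KobayashiMainConjectureSmallImage.TeichSpanLevelDescent

end
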